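import Summits.HodgeConjecture.CorCM.B01.Transposition.Item2Holds
import Literature.NumberTheory.ComplexMultiplication.ReflexOfConjugateType
import HarnessLib

/-!
# Transposition item (ii), addendum: the inverse type does not see the conjugation of the base embedding

COR-CM (cell pub-hodgecm2), TRANSPOSITION dictionary item (ii) of rfwf v3 §4.2 (tex l. 236–244), writer of record
`pub-hodgecm2-tr-prover-2` (lead pre-ACK of the path family `Transposition/Item2Holds*.lean`, HOME/INBOX l. 3654 / l. 3752).
FRAMING (coordinator ruling 2026-08-21T11:55:35Z, binding): `HC_CM` is NOT proved; this file proves finite Galois bookkeeping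
about CM types and nothing more.

The interface file `Item2Reflex.lean` (p272885) says in its module docstring (l. 68–69): «with base point `1`:
`σ ∘ g ∈ Ψ_i ↔ σ ∘ g⁻¹ ∈ Θ_i` (the same set results from `σ̄ = σ ∘ c` in place of `σ`, `c` being central with `c⁻¹ = c)».
This file makes that parenthesis a kernel theorem, in the vocabulary of `Item2Holds.lean` (p276145):

* §1 `conjugate σ = (starRingEnd ℂ).comp σ` (the spelling `ῑ₁ := (starRingEnd ℂ).comp ι₁` used by the pinning files) and
  `(σ̄) ∘ g = conj (σ ∘ g)`;
* §2 **`invEmb_conjugate_left : κ_{σ̄} = κ_σ`** — the inversion through the conjugate base embedding is the same involution of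
  `Hom(F, ℂ)` (write `τ = σ̄ ∘ g = σ ∘ (c g)`; then `κ_{σ̄} τ = σ̄ ∘ g⁻¹ = σ ∘ c g⁻¹` and `κ_σ τ = σ ∘ (c g)⁻¹ = σ ∘ g⁻¹ c`, equal
  because `c = complexConj F` is central and `c⁻¹ = c`); `κ_σ σ̄ = σ̄`;
* §3 **`invType_conjugate_left : Θ^{*σ̄} = Θ^{*σ}`** (`invType (conjugate σ) Θ = invType σ Θ`), its `starRingEnd` spelling,
  and `bar_invType : (Θ^{*σ})‾ = (Θ̄)^{*σ}` (conjugating the TYPE does change the inverse type: it conjugates it);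
* §4 the RELATION form consumed by the pinning junctions (`hμ` of `Transposition/Item6PinMatch.lean`:195/:349, `hΘ` of
  `CorCM/CMSideReachOfInverseType.lean`:109, `Item2Datum.isInverse`): `isInverse_iff_eq_invType` (the relation through `σ`
  between `Ψ` and `Θ` holds iff `Ψ = Θ^{*σ}`) and **`isInverse_conjugate_left_iff`** — the relation through `σ̄` holds iff the
  relation through `σ` holds.  Consequence for a pin along `ῑ₁ = conj ∘ ι₁` (package «P2′» of the pinning lane): a
  σ-parametric type-selection binder «`σ ∘ g ∈ Φ_μ ↔ σ ∘ g⁻¹ ∈ Φ`» instantiated at `σ := ῑ₁` selects the SAME CM type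
  `Φ_μ = Φ^{*ι₁}` of `F` as at `σ := ι₁`; whatever conjugation the pin along `ῑ₁` costs is carried by the `ῑ₁`-compatible
  inclusion of the reflex field and by the complex pin, not by the type `Φ_μ`;
* §5 the REFLEX data through `σ̄` (the other tokens of those junctions: `algValuedIn ι₁ Θ.1`, `reflexField ℚ F (algValuedIn ι₁ Θ.1)`,
  `reflexCMType ι₁ Θ id`): reading a complex type through `σ̄` is reading its CONJUGATE type through `σ`
  (`algValuedIn_conjugate_left : algValuedIn σ̄ Θ = algValuedIn σ Θ̄`, pointwise the `ρ = conjGal`-translate,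
  `mem_algValuedIn_conjugate_left_iff`), hence the reflex FIELD through `σ̄` is the reflex field through `σ`
  (`reflexField_algValuedIn_conjugate_left`, by the tree's `reflexField_algValuedIn_bar`, [Liu2021] Rem. 4.4 «`M'_{μ^c} = M'_μ`»),
  and the reflex TYPE through `σ̄` is governed by the tree's `reflexCMType_bar` («`Ψ_{μ^c}` is the opposite type») — not
  restated here.

References: PerL v5 (eq. Psit) `Ψ_t = φʰ Φ̃_t⁻¹` and Remark 2.4; rfwf v3 l. 222 `Ψ_i := φʰ Θ_i⁻¹`; [Y1neg] Thm 8.1 (a)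
(base point `φʰ ∈ {1, c}`).  No `sorry`, no new axiom, no definition, no named fact; axioms `propext`, `Classical.choice`,
`Quot.sound`.  T5: n/a (no hypothesis binders).
-/

noncomputable section

namespace Summit.HodgeConjecture.CorCM

namespace Transposition

open Literature.AlgebraicGeometry.Motives (CMType)
open NumberField NumberField.ComplexEmbedding
open Literature.NumberTheory.ComplexMultiplication
open Literature.NumberTheory.ComplexMultiplication.CMTypeOps

variable {F : CMField}

/-! ### §1 The conjugate base embedding -/

/-- Mathlib's `conjugate σ` is `(starRingEnd ℂ) ∘ σ` — the spelling `ῑ₁ := (starRingEnd ℂ).comp ι₁` of the pinning files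
(`Transposition/Item6PinReachAlong.lean` §4). [folklore] -/
theorem conjugate_eq_starRingEnd_comp (σ : F →+* ℂ) : conjugate σ = (starRingEnd ℂ).comp σ := rfl

/-- `σ̄ ∘ g = conj ∘ (σ ∘ g)`. [folklore] -/
theorem conjugate_comp_algEquiv (σ : F →+* ℂ) (g : F ≃ₐ[ℚ] F) :
    (conjugate σ).comp (g : F →+* F) = conjugate (σ.comp (g : F →+* F)) :=
  RingHom.ext fun _ => rfl

variable [IsGalois ℚ F]

/-- `σ̄ ∘ g = σ ∘ (g followed by c)`, `c = complexConj F` (complex conjugation of the CM field is ONE Galois element under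
every embedding, Mathlib `IsCMField.complexEmbedding_complexConj`). [folklore] -/
theorem conjugate_comp_algEquiv_eq_comp_trans (σ : F →+* ℂ) (g : F ≃ₐ[ℚ] F) :
    (conjugate σ).comp (g : F →+* F) = σ.comp ((g.trans ((IsCMField.complexConj F).restrictScalars ℚ)) : F →+* F) := by
  rw [conjugate_comp_algEquiv, comp_trans_conj]

/-! ### §2 `κ_{σ̄} = κ_σ` -/

/-- **`κ_{σ̄} = κ_σ`**: the inversion of `Hom(F, ℂ)` through the conjugate base embedding `σ̄` is the inversion through `σ`
(`τ = σ̄ ∘ g = σ ∘ (c g)`, `κ_{σ̄} τ = σ̄ ∘ g⁻¹`, `κ_σ τ = σ ∘ (c g)⁻¹ = σ ∘ g⁻¹ c = σ̄ ∘ g⁻¹` as `c` is central with `c⁻¹ = c`;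
`Item2Reflex.lean` l. 68–69 «the same set results from `σ̄ = σ ∘ c` in place of `σ`»; PerL Remark 2.4). [folklore] -/
theorem invEmb_conjugate_left (σ τ : F →+* ℂ) : invEmb (conjugate σ) τ = invEmb σ τ := by
  obtain ⟨g, rfl⟩ := exists_algEquiv_comp_eq (conjugate σ) τ
  rw [invEmb_comp, conjugate_comp_algEquiv σ g.symm, ← comp_conj_trans σ g.symm,
    conjugate_comp_algEquiv_eq_comp_trans σ g, invEmb_comp]
  refine RingHom.ext fun x => ?_
  simp only [comp_algEquiv_apply, AlgEquiv.symm_trans_apply, AlgEquiv.trans_apply, conj_restrictScalars_symm_apply,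
    AlgEquiv.coe_restrictScalars]

/-- The same with the `starRingEnd` spelling of `σ̄`. [folklore] -/
theorem invEmb_starRingEnd_comp (σ τ : F →+* ℂ) : invEmb ((starRingEnd ℂ).comp σ) τ = invEmb σ τ :=
  invEmb_conjugate_left σ τ

/-- `κ_σ σ̄ = σ̄` (`κ_σ` fixes `σ` and commutes with conjugation). [folklore] -/
theorem invEmb_conjugate_self (σ : F →+* ℂ) : invEmb σ (conjugate σ) = conjugate σ := by
  rw [invEmb_conjugate, invEmb_self]

/-! ### §3 `Θ^{*σ̄} = Θ^{*σ}` and `(Θ^{*σ})‾ = (Θ̄)^{*σ}` -/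

/-- **`Θ^{*σ̄} = Θ^{*σ}`**: the inverse type of `Θ` through the conjugate base embedding equals the inverse type through `σ`
(`Item2Reflex.lean` l. 68–69; rfwf l. 222; PerL (eq. Psit), Remark 2.4). [folklore] -/
theorem invType_conjugate_left (σ : F →+* ℂ) (Θ : CMType F) : invType (conjugate σ) Θ = invType σ Θ := by
  apply Subtype.ext
  ext τ
  change invEmb (conjugate σ) τ ∈ Θ.1 ↔ invEmb σ τ ∈ Θ.1
  rw [invEmb_conjugate_left]

/-- The same with the `starRingEnd` spelling of `σ̄`. [folklore] -/
theorem invType_starRingEnd_comp (σ : F →+* ℂ) (Θ : CMType F) : invType ((starRingEnd ℂ).comp σ) Θ = invType σ Θ :=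
  invType_conjugate_left σ Θ

/-- **`(Θ^{*σ})‾ = (Θ̄)^{*σ}`**: conjugating the type conjugates its inverse type (base point `c` instead of `1`, [Y1neg]
Thm 8.1 (a); `Item2Reflex.lean` l. 69 «base point `c` replaces `Ψ_i` by its conjugate type `Ψ̄_i`»). [folklore] -/
theorem bar_invType (σ : F →+* ℂ) (Θ : CMType F) : bar (invType σ Θ) = invType σ (bar Θ) :=
  Subtype.ext (Set.ext fun _ => Iff.rfl)

/-- Membership spelling of `bar_invType`: `τ ∈ (Θ̄)^{*σ} ↔ conj ∘ τ ∈ Θ^{*σ}`. [folklore] -/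
theorem mem_invType_bar_iff (σ : F →+* ℂ) (Θ : CMType F) (τ : F →+* ℂ) :
    τ ∈ (invType σ (bar Θ)).1 ↔ conjugate τ ∈ (invType σ Θ).1 := by
  rw [← bar_invType, mem_bar_iff, conjugate_mem_iff_notMem]

/-! ### §4 The relation form consumed by the pinning junctions -/

/-- **The `isInverse` relation through `σ` determines the type**: (for all `g ∈ Gal(F/ℚ)`: `σ ∘ g ∈ Ψ ↔ σ ∘ g⁻¹ ∈ Θ`) holds
iff `Ψ = Θ^{*σ}` (`eq_invType_of_isInverse` and `comp_mem_invType_iff` of `Item2Holds.lean`).  This is the shape of the binders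
`hμ` (`Transposition/Item6PinMatch.lean`:195), `hΘ` (`CorCM/CMSideReachOfInverseType.lean`:109) and of `Item2Datum.isInverse`.
[folklore] -/
theorem isInverse_iff_eq_invType (σ : F →+* ℂ) (Θ Ψ : CMType F) :
    (∀ g : F ≃ₐ[ℚ] F, σ.comp (g : F →+* F) ∈ Ψ.1 ↔ σ.comp (g.symm : F →+* F) ∈ Θ.1) ↔ Ψ = invType σ Θ := by
  refine ⟨eq_invType_of_isInverse σ, fun h g => ?_⟩
  rw [h]
  exact comp_mem_invType_iff σ Θ g

/-- **The relation through `σ̄` is the relation through `σ`**: (for all `g`: `σ̄ ∘ g ∈ Ψ ↔ σ̄ ∘ g⁻¹ ∈ Θ`) iff (for all `g`: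
`σ ∘ g ∈ Ψ ↔ σ ∘ g⁻¹ ∈ Θ`) — both say `Ψ = Θ^{*σ}` (`invType_conjugate_left`).  For the pinning lane: a σ-parametric
type-selection binder instantiated at the conjugate embedding `ῑ₁` selects the same CM type of `F` as at `ι₁`. [folklore] -/
theorem isInverse_conjugate_left_iff (σ : F →+* ℂ) (Θ Ψ : CMType F) :
    (∀ g : F ≃ₐ[ℚ] F, (conjugate σ).comp (g : F →+* F) ∈ Ψ.1 ↔ (conjugate σ).comp (g.symm : F →+* F) ∈ Θ.1) ↔
      (∀ g : F ≃ₐ[ℚ] F, σ.comp (g : F →+* F) ∈ Ψ.1 ↔ σ.comp (g.symm : F →+* F) ∈ Θ.1) := by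
  rw [isInverse_iff_eq_invType, isInverse_iff_eq_invType, invType_conjugate_left]

/-- The same with the `starRingEnd` spelling of `σ̄`. [folklore] -/
theorem isInverse_starRingEnd_comp_iff (σ : F →+* ℂ) (Θ Ψ : CMType F) :
    (∀ g : F ≃ₐ[ℚ] F, ((starRingEnd ℂ).comp σ).comp (g : F →+* F) ∈ Ψ.1 ↔
        ((starRingEnd ℂ).comp σ).comp (g.symm : F →+* F) ∈ Θ.1) ↔
      (∀ g : F ≃ₐ[ℚ] F, σ.comp (g : F →+* F) ∈ Ψ.1 ↔ σ.comp (g.symm : F →+* F) ∈ Θ.1) :=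
  isInverse_conjugate_left_iff σ Θ Ψ

/-- One direction packaged for consumers: a type `Ψ` in the `isInverse` relation to `Θ` through `σ` is in the same relation
through `σ̄`. [folklore] -/
theorem isInverse_conjugate_left {σ : F →+* ℂ} {Θ Ψ : CMType F}
    (h : ∀ g : F ≃ₐ[ℚ] F, σ.comp (g : F →+* F) ∈ Ψ.1 ↔ σ.comp (g.symm : F →+* F) ∈ Θ.1) (g : F ≃ₐ[ℚ] F) :
    (conjugate σ).comp (g : F →+* F) ∈ Ψ.1 ↔ (conjugate σ).comp (g.symm : F →+* F) ∈ Θ.1 :=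
  (isInverse_conjugate_left_iff σ Θ Ψ).mpr h g

/-- The labels of any `Item2Datum` at the eigen-embedding `σ` are also the inverse types through `σ̄`
(`Item2Datum.Ψ_eq_invType` + `invType_conjugate_left`). [folklore] -/
theorem Item2Datum.Ψ_eq_invType_conjugate {U : Universe} {f : Face F} {ι₁ : F →+* ℂ} {V : HermSpace3 F ι₁} {σ : F →+* ℂ}
    (D : Item2Datum U f ι₁ V σ) (i : Fin 4) : D.Ψ i = invType (conjugate σ) (f.psi i) := by
  rw [invType_conjugate_left, D.Ψ_eq_invType i]

/-! ### §5 Reflex data through `σ̄` -/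

omit [IsGalois ℚ F] in
/-- Reading a complex type `Ψ ⊆ Hom(K, ℂ)` in `Hom_ℚ(K, F)` through `σ̄` is the `ρ`-translate (`ρ = conjGal`, complex
conjugation of the CM field `F` as a Galois element) of its reading through `σ`: `χ ∈ Ψ_{σ̄} ↔ ρ ∘ χ ∈ Ψ_σ`
(`σ̄ ∘ χ = conj ∘ (σ ∘ χ) = σ ∘ (ρ ∘ χ)`, tree `comp_coe_conjGal_smul`). [cite: Shimura1998, §8.1 Prop. 25] -/
theorem mem_algValuedIn_conjugate_left_iff {K : Type*} [Field K] [Algebra ℚ K] (σ : F →+* ℂ) (Ψ : Set (K →+* ℂ))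
    (χ : K →ₐ[ℚ] F) : χ ∈ algValuedIn (conjugate σ) Ψ ↔ (conjGal : F ≃ₐ[ℚ] F) • χ ∈ algValuedIn σ Ψ := by
  have h : (conjugate σ).comp (χ : K →+* F) = conjugate (σ.comp (χ : K →+* F)) := RingHom.ext fun _ => rfl
  rw [mem_algValuedIn_iff, mem_algValuedIn_iff, comp_coe_conjGal_smul, h]

omit [IsGalois ℚ F] in
/-- **Reading `Θ` through `σ̄` is reading `Θ̄` through `σ`**: `algValuedIn σ̄ Θ = algValuedIn σ Θ̄` as subsets of `Hom_ℚ(K, F)`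
(`σ̄ ∘ χ ∈ Θ ↔ conj ∘ (σ ∘ χ) ∈ Θ ↔ σ ∘ χ ∈ Θ̄`). [cite: MilneCM2006, Ch. I §1] -/
theorem algValuedIn_conjugate_left {K : Type*} [Field K] [Algebra ℚ K] (σ : F →+* ℂ) (Θ : CMType K) :
    algValuedIn (conjugate σ) Θ.1 = algValuedIn σ (bar Θ).1 :=
  Set.ext fun χ => by
    have h : (conjugate σ).comp (χ : K →+* F) = conjugate (σ.comp (χ : K →+* F)) := RingHom.ext fun _ => rfl
    rw [mem_algValuedIn_iff, mem_algValuedIn_iff, h, mem_bar_iff, conjugate_mem_iff_notMem]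

omit [IsGalois ℚ F] in
/-- **The reflex field does not see the conjugation of the base embedding**: `K*(σ̄, Θ) = K*(σ, Θ̄) = K*(σ, Θ)` as
intermediate fields of `F/ℚ` (`algValuedIn_conjugate_left` + the tree's `reflexField_algValuedIn_bar`, [Liu2021] Rem. 4.4
«`M'_{μ^c} = M'_μ`»).  For the pinning lane: the domain `reflexField ℚ F (algValuedIn ι₁ Θ.1)` of the inclusion binder `e` is
the same field at `ῑ₁`. [cite: Liu2021, Remark 4.4 (TeX ll. 1930–1933)] -/
theorem reflexField_algValuedIn_conjugate_left {K : Type*} [Field K] [Algebra ℚ K] (σ : F →+* ℂ) (Θ : CMType K) :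
    reflexField ℚ F (algValuedIn (conjugate σ) Θ.1) = reflexField ℚ F (algValuedIn σ Θ.1) := by
  rw [algValuedIn_conjugate_left, reflexField_algValuedIn_bar]

omit [IsGalois ℚ F] in
/-- The same with the `starRingEnd` spelling of `σ̄`. [cite: Liu2021, Remark 4.4 (TeX ll. 1930–1933)] -/
theorem reflexField_algValuedIn_starRingEnd_comp {K : Type*} [Field K] [Algebra ℚ K] (σ : F →+* ℂ) (Θ : CMType K) :
    reflexField ℚ F (algValuedIn ((starRingEnd ℂ).comp σ) Θ.1) = reflexField ℚ F (algValuedIn σ Θ.1) :=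
  reflexField_algValuedIn_conjugate_left σ Θ

end Transposition

end Summit.HodgeConjecture.CorCM

end
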